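import Mathlib
import Summits.Ventures.PercRepro2.TypedMarkedSeriesDefs
import Summits.Ventures.PercRepro2.TypedMarkedSeriesGraph
import Summits.Ventures.PercRepro2.TypedMarkedSeriesStateG
import Summits.Ventures.PercRepro2.TypedMarkedSeriesIdG1
import Summits.Ventures.PercRepro2.TypedMarkedSeriesIdG2
import Summits.Ventures.PercRepro2.TypedMarkedSeriesPos

/-!
# Rule G — `o` of degree two between `a₃` and `b`: every typed base is nonnegative (blind cell
PercRepro2, night-3 g14, 2026-08-27; `proofs/NIGHT3-CERT.md` §23.8)

The third marked-series positivity rule, by `typedCount_nonneg_of_model` with the state lemma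
`st_modelG` and the inequalities `identG_kl`: if `o` carries exactly the typed edges
`e = {a₃, o}`, `f = {o, b}` (every other edge at `o` pinned closed and untyped), the typed base is
nonnegative (`typedCount_nonneg_of_o_between_a3_b`).  With rules F and F′ this completes the
degree-2 marks whose two-edge block sums are nonnegative on every signature triple (kit j268129).
Nothing here asserts anything about the original lane.
-/

namespace Summit.Ventures.PercRepro2

open UnionCluster

namespace CovForm

namespace MarkedSeries

open OneTyped TypedA3 Untouched TypedRed

section RuleG

open Classical

variable {V : Type*} {E : Type*} [Fintype E] [DecidableEq E] {R : Type*} [Field R]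
  [LinearOrder R] [IsStrictOrderedRing R]
variable (ends : E → Sym2 V) (o a₁ a₂ a₃ b : V)

/-- **Rule G: `o` between `a₃` and `b` — every typed base is nonnegative.** -/
theorem typedCount_nonneg_of_o_between_a3_b {e f : E} (hef : e ≠ f) (he : ends e = s(a₃, o))
    (hf : ends f = s(o, b)) (ho1 : o ≠ a₁) (ho2 : o ≠ a₂) (ho3 : o ≠ a₃) (hob : o ≠ b)
    (F : Finset E) (heF : e ∈ F) (hfF : f ∈ F) (z : Config E) (τ : E → ℕ)
    (hτ : ∀ e ∈ F, τ e = 1 ∨ τ e = 2)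
    (hcl : ∀ e', e' ≠ e → e' ≠ f → o ∈ ends e' → e' ∉ F ∧ z e' = false) :
    0 ≤ typedCount F z τ (K3 ends o a₁ a₂ a₃ b : Config E → Config E → Config E → R) := by
  refine typedCount_nonneg_of_model ends o a₁ a₂ a₃ b F z τ hτ hef heF hfF
    (fun c12 c1b c13 c2b c23 _cb3 p a => (c12 || (p && a && (c23 || c2b) && (c13 || c1b)), (p && (c13 || (p && a && c1b))) || (a && (c1b || (p && a && c13))), (p && (c23 || (p && a && c2b))) || (a && (c2b || (p && a && c23))), (c1b || (p && a && c13)), (c2b || (p && a && c23)), (c13 || (p && a && c1b)), (c23 || (p && a && c2b))))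
    (fun x => decide (Conn ends (Function.update (Function.update x e false) f false) a₁ a₂))
    (fun x => decide (Conn ends (Function.update (Function.update x e false) f false) a₁ b))
    (fun x => decide (Conn ends (Function.update (Function.update x e false) f false) a₁ a₃))
    (fun x => decide (Conn ends (Function.update (Function.update x e false) f false) a₂ b))
    (fun x => decide (Conn ends (Function.update (Function.update x e false) f false) a₂ a₃))
    (fun x => decide (Conn ends (Function.update (Function.update x e false) f false) b a₃))
    (fun x => consB_sig ends _ a₁ a₂ b a₃) (fun x hx p a => ?_) ?_
  · exact st_modelG ends o a₁ a₂ a₃ b hef he hf ho1 ho2 ho3 hob x (closed_on_support2 F z hcl x hx) p a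
  · intro k l hk hl
    rcases hk with rfl | rfl <;> rcases hl with rfl | rfl
    · exact identG_11
    · exact identG_12
    · exact identG_21
    · exact identG_22

end RuleG

end MarkedSeries

end CovForm

end Summit.Ventures.PercRepro2
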